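/-
Origin: expansion seat `planner-pub-hodgecm-mc-axioms-1-g14-0`, handover #W212 2026-08-20T15:53:55Z md5 c7be4c2c26e5 (PKG 92f76c5464cc → c7be4c2c26e5; 170 l.; MECHANICAL (iib-R) rewrite v3.1 of the PKG file as it stands (89 token edits; rules R1x1+RX[h₂]x88)) (`HOME/mc/pub-hodgecm-mc-axioms-1-g14/revendor/kit-r55/stage55/HodgeCM/Model/Binders/Real34PinsTotalKSA.lean`, md5 c7be4c2c26e5, 170 lines);
landed by the gen-22 packager (p-g22) in gate run 55 REPLACES the earlier landed copy of `HodgeCM/Model/Binders/Real34PinsTotalKSA.lean` (seat copy carried the packager Origin header of an earlier run (stripped)).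
-/
/-
Origin: speedrun cell pub-hodgecm, MODEL-CONSTRUCTION sub-cell, unit pub-hodgecm-mc-binder-1-g10 (BINDER PROVER, gen 10; node B2-meet,
BINDER-OWNERS row 15 `real34` at the TOTAL pins of record — RUN-38-world step), seat prover-pub-hodgecm-mc-binder-1-g10-0, 2026-08-20.
Target in PKG: HodgeCM/Model/Binders/Real34PinsTotalKSA.lean (NEW additive leaf, RUN 39+; imports #29 `Binders/Real34PinsTotalKA` and #30
`Binders/Real34PinsTotalKCensus`; needs theta-3's RUN-38 WHOLE-FILE REPLACEMENT (A) `Model/ThetaSpaceInputPin` 68c7c57560c1 — structure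
`ThetaAdelicSide` with the (L3)/(L3b) pin fields and the pin lemma `ThetaAdelicSide.exists_corrector_of_mem_levelImage`).
KERNEL ONLY: 0 records of published theorems, nothing cited, 0 `def … : Prop`, MODEL-N ±0, E unchanged.
Nothing here is a claim of the manuscripts under adjudication.
-/
import Summits.HodgeConjecture.HodgeCM.Model.Binders.Real34PinsTotalKA
import Summits.HodgeConjecture.HodgeCM.Model.Binders.Real34PinsTotalKCensus

/-!
# Row `real34` at the pins of record from the (34) CENSUS SIDES alone

#30 `Binders/Real34PinsTotalKCensus` (`real34_totalKSE`) at the `A`-slot pin of record `A := fun V c k => archLineInputOf (𝔄 V c) k` (theta-3 (E1))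
with `hAw := hAw_archLine` (rfl) and `hcorr := hcorr_total` ((A)'s pin lemma) from #29: **`Gen12Pins.real34_totalKSA 𝔄`** /
**`real34_totalKSAE 𝔄 (hpc hcup hph h31 hLiu) (CS)`** — E's binder `real34` VERBATIM from E's own binders and ONE `Real34CensusSide` per good
sextic context (= mc-binder-2's (34) census core of the context — the object that also discharges E's `hyp34` — plus the wedge decomposition
`hwedge` of its inserted printed vectors).  Nothing here is a claim of the manuscripts under adjudication.
-/

set_option autoImplicit false

noncomputable section

open MeasureTheory NumberField MulAction
open scoped Matrix InnerProductSpace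

namespace HodgeCM.Model

open HodgeCM HodgeCM.Universe HodgeCM.Adelic
open Literature.NumberTheory.Weil1964
open Literature.NumberTheory.Automorphic (piSchwartzBruhat)
open Literature.NumberTheory.Automorphic.UnitaryGroup (archIsotropy archIsotropyProj archKappa archSectionU21CM)
open Literature.NumberTheory.GelbartRogawski1991.UnitaryDualPair
open Literature.RepresentationTheory.HeisenbergGroup
open Literature.Geometry.ComplexHyperbolic.BallModel (U21 x₀ Jac)
open Literature.AlgebraicGeometry.HodgeTheory
open Literature.NumberTheory.Automorphic.PicardCM
open Literature.NumberTheory.Transcendental (Arapura2012_Cor_15_4_6)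
open HodgeCM.CMTypeOps (inflate)
open HodgeCM.Model.ThetaSpace
open HodgeCM.Model.ArchSideTerm

namespace Gen12Pins

variable
  (hGR : ∀ {L : CMField} {ι₁ : L →+* ℂ} (V : HermSpace3 L ι₁) (c : SeesawCtx L),
    (cmSplittingDatum (L : Type) finProdFinEquiv (frameD V) (frameD_real V) (frameD_ne V) (dW c.D) (dW_real c.D)
      (dW_ne c.D)).CompatibleSplitting)
  (η : ∀ {L : CMField} {ι₁ : L →+* ℂ} (V : HermSpace3 L ι₁) (c : SeesawCtx L),
    CMAdelic (L : Type) (frameD V) × CMAdelic (L : Type) (dW c.D) →* ℂˣ)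
  (hη : ∀ {L : CMField} {ι₁ : L →+* ℂ} (V : HermSpace3 L ι₁) (c : SeesawCtx L),
    ∀ γU ∈ CMRat (L : Type) (frameD V), ∀ γ ∈ CMRat (L : Type) (dW c.D), η V c (γU, γ) = 1)
  (hηc : ∀ {L : CMField} {ι₁ : L →+* ℂ} (V : HermSpace3 L ι₁) (c : SeesawCtx L), Continuous fun p => ((η V c p : ℂˣ) : ℂ))
  (hGR₀ : ∀ {L : CMField} {ι₁ : L →+* ℂ} (V : HermSpace3 L ι₁) (c : SeesawCtx L),
    (cmSplittingDatum (L : Type) (e₁) (frameD V) (frameD_real V) (frameD_ne V) (lineVec (L : Type) (dW c.D 0))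
      (fun _ => dW_real c.D 0) (fun _ => dW_ne c.D 0)).CompatibleSplitting)
  (hGR₁ : ∀ {L : CMField} {ι₁ : L →+* ℂ} (V : HermSpace3 L ι₁) (c : SeesawCtx L),
    (cmSplittingDatum (L : Type) (e₁) (frameD V) (frameD_real V) (frameD_ne V) (lineVec (L : Type) (dW c.D 1))
      (fun _ => dW_real c.D 1) (fun _ => dW_ne c.D 1)).CompatibleSplitting)
  (hGR₂ : ∀ {L : CMField} {ι₁ : L →+* ℂ} (V : HermSpace3 L ι₁) (c : SeesawCtx L),
    (cmSplittingDatum (L : Type) (e₁) (frameD V) (frameD_real V) (frameD_ne V) (lineVec (L : Type) (dW' c.D 0))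
      (fun _ => dW'_real c.D 0) (fun _ => dW'_ne c.D 0)).CompatibleSplitting)
  (hGR₃ : ∀ {L : CMField} {ι₁ : L →+* ℂ} (V : HermSpace3 L ι₁) (c : SeesawCtx L),
    (cmSplittingDatum (L : Type) (e₁) (frameD V) (frameD_real V) (frameD_ne V) (lineVec (L : Type) (dW' c.D 1))
      (fun _ => dW'_real c.D 1) (fun _ => dW'_ne c.D 1)).CompatibleSplitting)
  (A : ∀ {L : CMField} {ι₁ : L →+* ℂ} (V : HermSpace3 L ι₁) (c : SeesawCtx L) (k : Fin 4),
    ArchLineInput V (lineRepD V c.D (hGR V c) (hGR₀ V c) (hGR₁ V c) (hGR₂ V c) (hGR₃ V c) (η V c) k))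

variable (hHD : exists_isReal_hodgeModel) (hI : hodgePQ_independent_of_hodgeModel)
  (h₁ : BallQuotientUniformised)  (h₃ : CMAbelianVarietyRealised)
  (h : Bool) (hA : Arapura2012_Cor_15_4_6) (μ : ∀ {L : CMField}, SeesawCtx L → Fin 4 → InfinitePlace L → ℤ)

variable (𝔄 : ∀ {L : CMField} {ι₁ : L →+* ℂ} (V : HermSpace3 L ι₁) (c : SeesawCtx L),
    ArchLineDatum V c.D (hGR V c) (hGR₀ V c) (hGR₁ V c) (hGR₂ V c) (hGR₃ V c) (η V c) (μ c))

/-- **Row 15 (`real34`) at the pins of record from the (34) census sides** (quantified `pinT` form): #30 `real34_totalKS` at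
`A := fun V c k => archLineInputOf (𝔄 V c) k` with `hAw := hAw_archLine`, `hcorr := hcorr_total`. -/
theorem real34_totalKSA (hpc : (picardCMUniverse hHD hI h₁ h₃).Fact_pull_comp)
    (hcup : (picardCMUniverse hHD hI h₁ h₃).Fact_pull_cup) (hph : (picardCMUniverse hHD hI h₁ h₃).Fact_pull_hodge)
    (h31 : (picardCMUniverse hHD hI h₁ h₃).Fact_cmInflation)
    (hLiu : ∀ {L : CMField} {ι₁ : L →+* ℂ} (V : HermSpace3 L ι₁) (c : SeesawCtx L),
      (pinT hHD hI h₁ h₃ h hA (Wg @hGR @η @hη @hηc @τSyl @TSyl @hTSyl) (SInstance.S @hGR @η @hη @hηc @hGR₀ @hGR₁ @hGR₂ @hGR₃ (fun V c k => archLineInputOf (𝔄 V c) k)) μ).GoodCtx ι₁ c → Module.finrank ℚ c.K = 6 →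
      ∀ (i : Fin 4) (Γ : Level V), ∃ (M : CMField) (k : c.K →+* M) (σ' : M →+* ℂ), σ'.comp k = c.σ ∧
        (pinT hHD hI h₁ h₃ h hA (Wg @hGR @η @hη @hηc @τSyl @TSyl @hTSyl) (SInstance.S @hGR @η @hη @hηc @hGR₀ @hGR₁ @hGR₂ @hGR₃ (fun V c k => archLineInputOf (𝔄 V c) k)) μ).Theta V c i Γ ⊆ (picardCMUniverse hHD hI h₁ h₃).Uiso Γ M (inflate k (c.Ψ i)) σ')
    (CS : ∀ {L : CMField} {ι₁ : L →+* ℂ} (V : HermSpace3 L ι₁) (c : SeesawCtx L) (hV : IsAnisotropic L V.Hm),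
      (pinT hHD hI h₁ h₃ h hA (Wg @hGR @η @hη @hηc @τSyl @TSyl @hTSyl) (SInstance.S @hGR @η @hη @hηc @hGR₀ @hGR₁ @hGR₂ @hGR₃ (fun V c k => archLineInputOf (𝔄 V c) k)) μ).GoodCtx ι₁ c → Module.finrank ℚ c.K = 6 → Real34CensusSide @hGR @η @hη @hηc @hGR₀ @hGR₁ @hGR₂ @hGR₃ (fun V c k => archLineInputOf (𝔄 V c) k) hHD hI h₁ h₃ @μ V c hV)
    {L : CMField} {ι₁ : L →+* ℂ} (V : HermSpace3 L ι₁) (c : SeesawCtx L)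
    (hc : (pinT hHD hI h₁ h₃ h hA (Wg @hGR @η @hη @hηc @τSyl @TSyl @hTSyl) (SInstance.S @hGR @η @hη @hηc @hGR₀ @hGR₁ @hGR₂ @hGR₃ (fun V c k => archLineInputOf (𝔄 V c) k)) μ).GoodCtx ι₁ c) (hK : Module.finrank ℚ c.K = 6) :
    Nonempty ((pinT hHD hI h₁ h₃ h hA (Wg @hGR @η @hη @hηc @τSyl @TSyl @hTSyl) (SInstance.S @hGR @η @hη @hηc @hGR₀ @hGR₁ @hGR₂ @hGR₃ (fun V c k => archLineInputOf (𝔄 V c) k)) μ).Real34FunBridge V c) :=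
  real34_totalKS @hGR @η @hη @hηc @hGR₀ @hGR₁ @hGR₂ @hGR₃ (fun V c k => archLineInputOf (𝔄 V c) k) hHD hI h₁ h₃ h hA @μ hpc hcup hph h31 hLiu
    (hAw_archLine @hGR @η @hη @hηc @hGR₀ @hGR₁ @hGR₂ @hGR₃ hHD hI h₁ h₃ h hA @μ @𝔄)
    (fun V c hV => hcorr_total @hGR @η @hη @hηc @hGR₀ @hGR₁ @hGR₂ @hGR₃ (fun V c k => archLineInputOf (𝔄 V c) k) hHD hI h₁ h₃ V c hV)
    CS V c hc hK

/-- **E's binder `real34` VERBATIM at the pins of record from the (34) census sides** (E's own `thetaModelOf …` text). -/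
theorem real34_totalKSAE (hpc : (picardCMUniverse hHD hI h₁ h₃).Fact_pull_comp)
    (hcup : (picardCMUniverse hHD hI h₁ h₃).Fact_pull_cup) (hph : (picardCMUniverse hHD hI h₁ h₃).Fact_pull_hodge)
    (h31 : (picardCMUniverse hHD hI h₁ h₃).Fact_cmInflation)
    (hLiu : ∀ {L : CMField} {ι₁ : L →+* ℂ} (V : HermSpace3 L ι₁) (c : SeesawCtx L),
      (thetaModelOf hHD hI h₁ h₃ h (embOf hHD hI h₁ h₃) (coverOf hHD hI h₁ h₃ hA) (wmOfInput (Wg @hGR @η @hη @hηc @τSyl @TSyl @hTSyl)) (thetaOf _ (thetaClassInputOf _ (fun V c => thetaSpaceInputOf hHD hI h₁ h₃ (SInstance.S @hGR @η @hη @hηc @hGR₀ @hGR₁ @hGR₂ @hGR₃ (fun V c k => archLineInputOf (𝔄 V c) k)) V c))) (d12Of μ) (d34Of μ)).GoodCtx ι₁ c → Module.finrank ℚ c.K = 6 →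
      ∀ (i : Fin 4) (Γ : Level V), ∃ (M : CMField) (k : c.K →+* M) (σ' : M →+* ℂ), σ'.comp k = c.σ ∧
        (thetaModelOf hHD hI h₁ h₃ h (embOf hHD hI h₁ h₃) (coverOf hHD hI h₁ h₃ hA) (wmOfInput (Wg @hGR @η @hη @hηc @τSyl @TSyl @hTSyl)) (thetaOf _ (thetaClassInputOf _ (fun V c => thetaSpaceInputOf hHD hI h₁ h₃ (SInstance.S @hGR @η @hη @hηc @hGR₀ @hGR₁ @hGR₂ @hGR₃ (fun V c k => archLineInputOf (𝔄 V c) k)) V c))) (d12Of μ) (d34Of μ)).Theta V c i Γ ⊆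
          (picardCMUniverse hHD hI h₁ h₃).Uiso Γ M (inflate k (c.Ψ i)) σ')
    (CS : ∀ {L : CMField} {ι₁ : L →+* ℂ} (V : HermSpace3 L ι₁) (c : SeesawCtx L) (hV : IsAnisotropic L V.Hm),
      (pinT hHD hI h₁ h₃ h hA (Wg @hGR @η @hη @hηc @τSyl @TSyl @hTSyl) (SInstance.S @hGR @η @hη @hηc @hGR₀ @hGR₁ @hGR₂ @hGR₃ (fun V c k => archLineInputOf (𝔄 V c) k)) μ).GoodCtx ι₁ c → Module.finrank ℚ c.K = 6 → Real34CensusSide @hGR @η @hη @hηc @hGR₀ @hGR₁ @hGR₂ @hGR₃ (fun V c k => archLineInputOf (𝔄 V c) k) hHD hI h₁ h₃ @μ V c hV) :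
    ∀ {L : CMField} {ι₁ : L →+* ℂ} (V : HermSpace3 L ι₁) (c : SeesawCtx L),
      (thetaModelOf hHD hI h₁ h₃ h (embOf hHD hI h₁ h₃) (coverOf hHD hI h₁ h₃ hA) (wmOfInput (Wg @hGR @η @hη @hηc @τSyl @TSyl @hTSyl))
        (thetaOf _ (thetaClassInputOf _ (fun V c => thetaSpaceInputOf hHD hI h₁ h₃
          (SInstance.S @hGR @η @hη @hηc @hGR₀ @hGR₁ @hGR₂ @hGR₃ (fun V c k => archLineInputOf (𝔄 V c) k)) V c))) (d12Of μ) (d34Of μ)).GoodCtx ι₁ c →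
      Module.finrank ℚ c.K = 6 →
      Nonempty ((thetaModelOf hHD hI h₁ h₃ h (embOf hHD hI h₁ h₃) (coverOf hHD hI h₁ h₃ hA) (wmOfInput (Wg @hGR @η @hη @hηc @τSyl @TSyl @hTSyl))
        (thetaOf _ (thetaClassInputOf _ (fun V c => thetaSpaceInputOf hHD hI h₁ h₃
          (SInstance.S @hGR @η @hη @hηc @hGR₀ @hGR₁ @hGR₂ @hGR₃ (fun V c k => archLineInputOf (𝔄 V c) k)) V c))) (d12Of μ) (d34Of μ)).Real34FunBridge V c) :=
  fun V c hc hK => real34_totalKSA @hGR @η @hη @hηc @hGR₀ @hGR₁ @hGR₂ @hGR₃ hHD hI h₁ h₃ h hA @μ @𝔄 hpc hcup hph h31 hLiu CS V c hc hK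

/-! ## 2. The universe facts discharged (binder-free `hpc hcup hph`) -/

/-- **E's binder `real34` VERBATIM at the pins of record from the (34) census sides, with the three universe facts
`Fact_pull_comp/_cup/_hodge` DISCHARGED by the model universe's own `Model.modelAxiomsPerL` (FACTS.md M1/M2; KERNEL)** — hypotheses =
E's own `h31`∕`hLiu` (themselves fed by E's rows `hR`∕`hsmall`) + ONE `Real34CensusSide` per good sextic context.  Nothing of
`hpc hcup hph` should appear as a binder of an E cut that consumes this file. -/
theorem real34_totalKSAE₀ (h31 : (picardCMUniverse hHD hI h₁ h₃).Fact_cmInflation)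
    (hLiu : ∀ {L : CMField} {ι₁ : L →+* ℂ} (V : HermSpace3 L ι₁) (c : SeesawCtx L),
      (thetaModelOf hHD hI h₁ h₃ h (embOf hHD hI h₁ h₃) (coverOf hHD hI h₁ h₃ hA) (wmOfInput (Wg @hGR @η @hη @hηc @τSyl @TSyl @hTSyl)) (thetaOf _ (thetaClassInputOf _ (fun V c => thetaSpaceInputOf hHD hI h₁ h₃ (SInstance.S @hGR @η @hη @hηc @hGR₀ @hGR₁ @hGR₂ @hGR₃ (fun V c k => archLineInputOf (𝔄 V c) k)) V c))) (d12Of μ) (d34Of μ)).GoodCtx ι₁ c → Module.finrank ℚ c.K = 6 →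
      ∀ (i : Fin 4) (Γ : Level V), ∃ (M : CMField) (k : c.K →+* M) (σ' : M →+* ℂ), σ'.comp k = c.σ ∧
        (thetaModelOf hHD hI h₁ h₃ h (embOf hHD hI h₁ h₃) (coverOf hHD hI h₁ h₃ hA) (wmOfInput (Wg @hGR @η @hη @hηc @τSyl @TSyl @hTSyl)) (thetaOf _ (thetaClassInputOf _ (fun V c => thetaSpaceInputOf hHD hI h₁ h₃ (SInstance.S @hGR @η @hη @hηc @hGR₀ @hGR₁ @hGR₂ @hGR₃ (fun V c k => archLineInputOf (𝔄 V c) k)) V c))) (d12Of μ) (d34Of μ)).Theta V c i Γ ⊆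
          (picardCMUniverse hHD hI h₁ h₃).Uiso Γ M (inflate k (c.Ψ i)) σ')
    (CS : ∀ {L : CMField} {ι₁ : L →+* ℂ} (V : HermSpace3 L ι₁) (c : SeesawCtx L) (hV : IsAnisotropic L V.Hm),
      (pinT hHD hI h₁ h₃ h hA (Wg @hGR @η @hη @hηc @τSyl @TSyl @hTSyl) (SInstance.S @hGR @η @hη @hηc @hGR₀ @hGR₁ @hGR₂ @hGR₃ (fun V c k => archLineInputOf (𝔄 V c) k)) μ).GoodCtx ι₁ c → Module.finrank ℚ c.K = 6 → Real34CensusSide @hGR @η @hη @hηc @hGR₀ @hGR₁ @hGR₂ @hGR₃ (fun V c k => archLineInputOf (𝔄 V c) k) hHD hI h₁ h₃ @μ V c hV) :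
    ∀ {L : CMField} {ι₁ : L →+* ℂ} (V : HermSpace3 L ι₁) (c : SeesawCtx L),
      (thetaModelOf hHD hI h₁ h₃ h (embOf hHD hI h₁ h₃) (coverOf hHD hI h₁ h₃ hA) (wmOfInput (Wg @hGR @η @hη @hηc @τSyl @TSyl @hTSyl)) (thetaOf _ (thetaClassInputOf _ (fun V c => thetaSpaceInputOf hHD hI h₁ h₃ (SInstance.S @hGR @η @hη @hηc @hGR₀ @hGR₁ @hGR₂ @hGR₃ (fun V c k => archLineInputOf (𝔄 V c) k)) V c))) (d12Of μ) (d34Of μ)).GoodCtx ι₁ c →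
      Module.finrank ℚ c.K = 6 →
      Nonempty ((thetaModelOf hHD hI h₁ h₃ h (embOf hHD hI h₁ h₃) (coverOf hHD hI h₁ h₃ hA) (wmOfInput (Wg @hGR @η @hη @hηc @τSyl @TSyl @hTSyl)) (thetaOf _ (thetaClassInputOf _ (fun V c => thetaSpaceInputOf hHD hI h₁ h₃ (SInstance.S @hGR @η @hη @hηc @hGR₀ @hGR₁ @hGR₂ @hGR₃ (fun V c k => archLineInputOf (𝔄 V c) k)) V c))) (d12Of μ) (d34Of μ)).Real34FunBridge V c) :=
  real34_totalKSAE @hGR @η @hη @hηc @hGR₀ @hGR₁ @hGR₂ @hGR₃ hHD hI h₁ h₃ h hA @μ @𝔄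
    (Model.modelAxiomsPerL hHD hI h₃ h₁).pull_comp (Model.modelAxiomsPerL hHD hI h₃ h₁).pull_cup
    (Model.modelAxiomsPerL hHD hI h₃ h₁).pull_hodge h31 hLiu CS

/-- the same for the K-type-datum cut of #29 (`real34_totalKAE` with `hpc hcup hph` discharged). -/
theorem real34_totalKAE₀ (h31 : (picardCMUniverse hHD hI h₁ h₃).Fact_cmInflation)
    (hLiu : ∀ {L : CMField} {ι₁ : L →+* ℂ} (V : HermSpace3 L ι₁) (c : SeesawCtx L),
      (thetaModelOf hHD hI h₁ h₃ h (embOf hHD hI h₁ h₃) (coverOf hHD hI h₁ h₃ hA) (wmOfInput (Wg @hGR @η @hη @hηc @τSyl @TSyl @hTSyl)) (thetaOf _ (thetaClassInputOf _ (fun V c => thetaSpaceInputOf hHD hI h₁ h₃ (SInstance.S @hGR @η @hη @hηc @hGR₀ @hGR₁ @hGR₂ @hGR₃ (fun V c k => archLineInputOf (𝔄 V c) k)) V c))) (d12Of μ) (d34Of μ)).GoodCtx ι₁ c → Module.finrank ℚ c.K = 6 →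
      ∀ (i : Fin 4) (Γ : Level V), ∃ (M : CMField) (k : c.K →+* M) (σ' : M →+* ℂ), σ'.comp k = c.σ ∧
        (thetaModelOf hHD hI h₁ h₃ h (embOf hHD hI h₁ h₃) (coverOf hHD hI h₁ h₃ hA) (wmOfInput (Wg @hGR @η @hη @hηc @τSyl @TSyl @hTSyl)) (thetaOf _ (thetaClassInputOf _ (fun V c => thetaSpaceInputOf hHD hI h₁ h₃ (SInstance.S @hGR @η @hη @hηc @hGR₀ @hGR₁ @hGR₂ @hGR₃ (fun V c k => archLineInputOf (𝔄 V c) k)) V c))) (d12Of μ) (d34Of μ)).Theta V c i Γ ⊆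
          (picardCMUniverse hHD hI h₁ h₃).Uiso Γ M (inflate k (c.Ψ i)) σ')
    (D : ∀ {L : CMField} {ι₁ : L →+* ℂ} (V : HermSpace3 L ι₁) (c : SeesawCtx L) (hV : IsAnisotropic L V.Hm)
      (hc : (pinT hHD hI h₁ h₃ h hA (Wg @hGR @η @hη @hηc @τSyl @TSyl @hTSyl) (SInstance.S @hGR @η @hη @hηc @hGR₀ @hGR₁ @hGR₂ @hGR₃ (fun V c k => archLineInputOf (𝔄 V c) k)) μ).GoodCtx ι₁ c), Module.finrank ℚ c.K = 6 →
        Real34KTypeDatum hHD hI h₁ h₃ h hA (Wg @hGR @η @hη @hηc @τSyl @TSyl @hTSyl) (SInstance.S @hGR @η @hη @hηc @hGR₀ @hGR₁ @hGR₂ @hGR₃ (fun V c k => archLineInputOf (𝔄 V c) k)) μ V c hV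
          (SeesawHyp34.ofTotal @hGR @η @hη @hηc @hGR₀ @hGR₁ @hGR₂ @hGR₃ (fun V c k => archLineInputOf (𝔄 V c) k) V c
            (planeDefinite_of_goodCtx @hGR @η @hη @hηc @hGR₀ @hGR₁ @hGR₂ @hGR₃ (fun V c k => archLineInputOf (𝔄 V c) k) hHD hI h₁ h₃ h hA @μ c hc))
          (adm₃₄ hHD hI h₁ h₃ ((SInstance.S @hGR @η @hη @hηc @hGR₀ @hGR₁ @hGR₂ @hGR₃ (fun V c k => archLineInputOf (𝔄 V c) k)) V c) hV)) :
    ∀ {L : CMField} {ι₁ : L →+* ℂ} (V : HermSpace3 L ι₁) (c : SeesawCtx L),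
      (thetaModelOf hHD hI h₁ h₃ h (embOf hHD hI h₁ h₃) (coverOf hHD hI h₁ h₃ hA) (wmOfInput (Wg @hGR @η @hη @hηc @τSyl @TSyl @hTSyl)) (thetaOf _ (thetaClassInputOf _ (fun V c => thetaSpaceInputOf hHD hI h₁ h₃ (SInstance.S @hGR @η @hη @hηc @hGR₀ @hGR₁ @hGR₂ @hGR₃ (fun V c k => archLineInputOf (𝔄 V c) k)) V c))) (d12Of μ) (d34Of μ)).GoodCtx ι₁ c →
      Module.finrank ℚ c.K = 6 →
      Nonempty ((thetaModelOf hHD hI h₁ h₃ h (embOf hHD hI h₁ h₃) (coverOf hHD hI h₁ h₃ hA) (wmOfInput (Wg @hGR @η @hη @hηc @τSyl @TSyl @hTSyl)) (thetaOf _ (thetaClassInputOf _ (fun V c => thetaSpaceInputOf hHD hI h₁ h₃ (SInstance.S @hGR @η @hη @hηc @hGR₀ @hGR₁ @hGR₂ @hGR₃ (fun V c k => archLineInputOf (𝔄 V c) k)) V c))) (d12Of μ) (d34Of μ)).Real34FunBridge V c) :=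
  real34_totalKAE @hGR @η @hη @hηc @hGR₀ @hGR₁ @hGR₂ @hGR₃ hHD hI h₁ h₃ h hA @μ @𝔄
    (Model.modelAxiomsPerL hHD hI h₃ h₁).pull_comp (Model.modelAxiomsPerL hHD hI h₃ h₁).pull_cup
    (Model.modelAxiomsPerL hHD hI h₃ h₁).pull_hodge h31 hLiu D

end Gen12Pins

end HodgeCM.Model

end
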